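import Mathlib
import Summits.ValiantsHypothesis.ValiantsHypothesis.Theorems.LacunarySymmetroidMatrixDescartesCensusLogPrimesTable

/-!
# `MatrixDescartes` census — W4 boundary layer: supplementary NUMERAL FACTS for the kernel kill of `ZP(1..17)` on `(0,3,4,9,22,38)`

HONEST FRAMING.  Object-search cell `pub-symmetroid`, item `DoorA26 = PosRootLawAt 2 6 19` (stmt-ValiantsHypothesis-19979, OPEN, typed,
never asserted).  Companion («Rows9») file of `…CensusZp117On000304092238` (theorem `countP_posRoots_zp_1_17_le_on_0_3_4_9_22_38`): the log-table numerals
`log N = Σ k·log p` over the prime table that its leaf certificates cite and no other module declares (engine-1 g30 supplement to the generated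
Rows chunks).  Pure arithmetic (`LogPrimes.log_nat_eq_of_factored`).

[folklore] Integer arithmetic; no source.
-/

-- `Summit.ValiantsHypothesis.ValiantsHypothesis.…` repeats a component by the D-0017 layout
-- (single-conjunct summit), which the `dupNamespace` linter flags; the name is mandated.
set_option linter.dupNamespace false

namespace Summit.ValiantsHypothesis.ValiantsHypothesis.Theorems.LacunarySymmetroidMatrixDescartes.Census

/-- `log 369` (a log-table numeral of this support's certificate) over the prime table (generated). [folklore] -/
theorem zp_1_17_on_0_3_4_9_22_38_lg_369 : Real.log (369 : ℝ) = 2 * Real.log (3 : ℝ) + 1 * Real.log (41 : ℝ) := by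
  have h := LogPrimes.log_nat_eq_of_factored 369 0 2 0 0 0 0 0 0 0 0 0 0 1 0 0 0 0 0 0 0 0 0 (by norm_num); push_cast at h; linarith only [h]

end Summit.ValiantsHypothesis.ValiantsHypothesis.Theorems.LacunarySymmetroidMatrixDescartes.Census
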